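import Literature.MathematicalPhysics.QuantumFieldTheory.Balaban1983to89.B9Eq373DerivativeRemainderL2

/-!
# `Balaban1983to89.B9Eq373DerivativeRemainderTwoBackgrounds` — T. Bałaban, *Propagators for lattice gauge theories in a background field*, Commun.
# Math. Phys. **99** (1985) 389–434 [Balaban1985BackgroundPropagators] (3.70)–(3.73) pp. 404–405 (with (3.3)/(3.4) p. 391, (3.8)–(3.10) p. 392,
# (3.23) p. 394, (3.82) p. 407): THE REMAINDERS OF THE DIFFERENTIAL LETTERS `D_U`, `D*_U`, `Δ^η_U = D*_U D_U` AND THE BOND CURL `D*_U D_U` BETWEEN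
# TWO GENERAL BACKGROUNDS `U`, `U′` — print's `V₁(A)`, `V₃(A)` of `Δ_a(U′U) = Δ_a(U) − V₃(A) − …` AT A GENERAL `U` (not only `U = 1`), as crude
# operator bounds on the pub-balaban NE9 chain's weighted `L²` spaces: transporters `δR`-close TO EACH OTHER give remainders `O(δR)`

statement-level skeleton of published theorems with citation tags; proofs where landed; nothing here is a claim about the Yang–Mills mass gap

PDF held: `paper:balaban1985-cmp99-background-propagators` (journal page = PDF page + 388); pp. 404–405, 407 through the verbatim quotations of
`B9Eq373DerivativeRemainderL2` (NE9 owner gen 80), whose architecture this file mirrors theorem by theorem.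

CITATION HEADER (lean-in-tree rule 2026-08-18).  Audit cell `pub-balaban`, sub-cell `t4`, NE9 crux team (2): LEAF PROVER 04
(`b2b-balaban-t4-ne9-formalise-leaf-04` gen 73), INTENT I-ne9leaf04-g73-2 — the TWO-BACKGROUND twin of the NE9 owner's (B)
`B9Eq373DerivativeRemainderL2` (flat base point `R₁ = 1`), item (i) of the owner's census (journal `CLAIMS.log` l.42142: «two-general-fields
Lipschitz needs two-background twins of (B)∕(ρ′)∕(δ_Q) (flat-point-only today)»), the (B) third; companion of this lineage's
`B9Eq379QLipschitzGeneral` (the (δ_Q) third).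

THE PRINT (verbatim, as quoted in `B9Eq373DerivativeRemainderL2`).  p. 404–405, (3.70)–(3.71): *«(D_{U′U}A′)_{μν}(x) = (D_U A′)_{μν}(x) +
η⁻¹(exp ηi ad A_μ(x) − 1)R(U(x, x+ηe_μ))A′_ν(x+ηe_μ) − … = (D*DA′)_μ(x) − (V₁(A)A′)_μ(x)»*; (3.73): *«The operator V₁ satisfies |(V₁(A)A′)(b)| ≤
O(1)(…)(|A||A′| + …) … The constant O(1) is an absolute constant depending on d only.»*; p. 407, (3.82): *«Δ_a(U′U) = … = Δ_a(U) − V₃(A) − P₁(A) −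
P₂(A). The operator V₃(A) is a local differential operator of the first order satisfying the bound (3.73).»*  Print's `U` here is a GENERAL
background and `U′ = e^{iηA}` the perturbation: the comparison is between `U′U` and `U`, not between `U′U` and `1`.

WHY THIS FILE (cell context).  The NE9 chain's chart of the curve species is Lipschitz in the background AT THE FLAT POINT
(`Support/NE9CurChartLipschitzAtFlat`, owner gen 82); between TWO GENERAL small-bond backgrounds every letter of the principal gauge-fixed operator
`D*D + DR(U)D* + aQ(U)*Q(U)` must be compared at `U` and `U′`.  `B9Eq373DerivativeRemainderL2` compares the differential letters with ABSTRACT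
transporter data `R` (`εR`-close to the identity on the fibre) against the FLAT pair `R₁ = S₁ = 1`; this file compares two such data `R`, `R′`
that are `δR`-close to each other (`‖R(b)w − R′(b)w‖ ≤ δR‖w‖` — for `R(U(b))X = U(b)XU(b)⁻¹` this is `O(‖U(b) − U′(b)‖)`), each `εR`-close to
the identity.  The flat file is the case `R′ = 1`, `δR = εR`.

WHAT IS PROVED (sorry-free; no `Prop` placeholder; no new definition; no inequality of the paper asserted as a hypothesis-free fact).
* §1 **`norm_covDerivL2K_sub_le₂`** (`‖(D_R − D_{R′})f‖ ≤ ‖c‖·δR·√d·‖f‖`), **`norm_covDivL2K_sub_le₂`** (the adjoint: `D*_S − D*_{S′}`),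
  **`norm_covLaplaceSiteK_sub_le₂`** (`‖(Δ_{R,S} − Δ_{R′,S′})λ‖ ≤ 4(1+εR)·‖c‖²·d·δR·‖λ‖`).
* §2 `norm_covCurl_sub_apply_le₂` (pointwise: the factor `R(b) − R′(b)` sits on the two transported edges of `∂p`), **`norm_covCurlL2K_sub_le₂`**
  (`4√d·‖c‖·δR`), **`norm_principal_sub_le₂`** (`‖(D*_S D_R − D*_{S′}D_{R′})A‖ ≤ 32d·(1+εR)·‖c‖²·δR·‖A‖`).
MODEL / DECLARED READINGS.  (M1) as `B9Eq373DerivativeRemainderL2` ∕ `B9Eq310HessianOperator` ∕ `B11Eq103H1Complex`: periodic lattice `TSite d Pd`,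
fibre `W` (a `𝕜`-inner product space), uniform weight `c₀`, scalar `c`; transporter data `R`, `R′`, `S`, `S′` abstract.  (M2) hypotheses: `εR, δR ≥ 0`,
`‖R(b)w − w‖, ‖R′(b)w − w‖ ≤ εR‖w‖` (ONE closeness letter for both — take the max), `‖R(b)w − R′(b)w‖ ≤ δR‖w‖`, `conj c = c`, mutual adjointness
`⟪R(b)v, u⟫ = ⟪v, S(b)u⟫` and `⟪R′(b)v, u⟫ = ⟪v, S′(b)u⟫` for the `D*`∕cocurl statements.  (M3) the constants `√d`, `4√d`, `4(1+εR)d`, `32d(1+εR)`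
are this file's witnesses for print's `O(1)` (crude, as in the flat file).
HONEST SCOPE.  Elementary bookkeeping on the chain's OWN lattice operators ([folklore] transfer of the flat file's proofs to a second transporter
datum); no estimate of the paper at its printed strength (no `|A||A′|` structure, no analyticity, no uniformity beyond the explicit constants); ONE
group of displayed letters of a two-general-backgrounds chart, NOT that chart, NOT NE9; NOT summit progress (cell pub-balaban: NE9 NOT PRINTED ∕ NOT
PROVED; spine PROVED 0∕9; rung (B)+1 on a finite T⁴ — NOT infinite volume, NOT mass gap, NOT Clay).  NEW file importing `B9Eq373DerivativeRemainderL2`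
only (its tools `norm_le_of_sum_sq_le`, `norm_adjoint_apply_le`, `sum_bond_btgt`, `norm_transport_le`, `norm_covDerivL2K_le`, `norm_covDivL2K_le`,
`norm_plaq_le_of_edge_bound`, `norm_covCurlL2K_le` REUSED BY NAME); nothing of the NE9-owner lineage's files is modified.  Net new unproved facts: 0.
-/

noncomputable section

open scoped InnerProductSpace ComplexConjugate BigOperators
open Finset

namespace Literature.MathematicalPhysics.QuantumFieldTheory.Balaban1983to89.B9Eq373DerivativeRemainderTwoBackgrounds

open B9SectCLatticeCarrier (Bond DirPair shift unshift bpos btgt)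
open B4Sect5Torus (TSite)
open B9Eq311L2Pairing (WL2)
open B11Eq103H1Complex (SiteL2K BondL2K covDerivL2K covDivL2K covLaplaceSiteK equiv_covDerivL2K adjoint_covDerivL2K)
open B9Eq310HessianOperator (PlaqL2K covCurlL2K covCoCurlL2K equiv_covCurlL2K adjoint_covCurlL2K)
open B9Eq33CovDerivVector (covDeriv_apply shiftEquiv)
open B9Eq34CovCurlVector (covCurl_apply_coord)
open B9Ineq369CurvatureSmall (edgeBond sum_edge_le)
open B9Eq373DerivativeRemainderL2 (norm_le_of_sum_sq_le norm_adjoint_apply_le sum_bond_btgt norm_transport_le norm_covDerivL2K_le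
  norm_covDivL2K_le norm_plaq_le_of_edge_bound norm_covCurlL2K_le)

/-! ## §1 The covariant derivative `D` ((3.3)), its adjoint `D*` ((3.8)) and `Δ^η_U = D*D` ((3.23)) between two transporter data -/

section Deriv

variable {𝕜 : Type*} [RCLike 𝕜] {d : ℕ} {Pd : Fin d → ℕ} {W : Type*} [NormedAddCommGroup W] [InnerProductSpace 𝕜 W]
  {c₀ : ℝ} [Fact (0 < c₀)] (c : 𝕜)
  {R R' : Bond d Pd → W →ₗ[𝕜] W} {εR δR : ℝ}

/-- **THE REMAINDER OF `D_U` AGAINST `D_{U′}` ON `L²`** — the first-order term of (3.70) between two general backgrounds, as a crude bound: if the two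
transporter data are `δR`-close on the fibre (`‖R(b)w − R′(b)w‖ ≤ δR‖w‖`; print: `R(U′U(b)) − R(U(b)) = (exp(ηi ad A) − 1)R(U(b))`), then
`‖(D_R − D_{R′})f‖ ≤ ‖c‖·δR·√d·‖f‖`. [cite: Balaban1985BackgroundPropagators, (3.70)–(3.71) pp.404–405, (3.73) p.405] -/
theorem norm_covDerivL2K_sub_le₂ (hδR : 0 ≤ δR) (hRR' : ∀ b w, ‖R b w - R' b w‖ ≤ δR * ‖w‖) (f : SiteL2K 𝕜 d Pd c₀ W) :
    ‖covDerivL2K 𝕜 c₀ c R f - covDerivL2K 𝕜 c₀ c R' f‖ ≤ ‖c‖ * δR * Real.sqrt d * ‖f‖ := by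
  have hc₀ : 0 < c₀ := Fact.out
  refine norm_le_of_sum_sq_le f _ (by positivity) ?_
  have hpt : ∀ b : Bond d Pd, c₀ * ‖WL2.equiv 𝕜 _ W (covDerivL2K 𝕜 c₀ c R f - covDerivL2K 𝕜 c₀ c R' f) b‖ ^ 2 ≤
      (‖c‖ * δR) ^ 2 * (c₀ * ‖WL2.equiv 𝕜 _ W f (btgt b)‖ ^ 2) := fun b => by
    rw [WL2.equiv_sub, Pi.sub_apply, equiv_covDerivL2K, equiv_covDerivL2K, covDeriv_apply, covDeriv_apply, ← smul_sub,
      sub_sub_sub_cancel_right, norm_smul]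
    have h := hRR' b (WL2.equiv 𝕜 _ W f (btgt b))
    have : (‖c‖ * ‖R b (WL2.equiv 𝕜 _ W f (btgt b)) - R' b (WL2.equiv 𝕜 _ W f (btgt b))‖) ^ 2 ≤
        (‖c‖ * (δR * ‖WL2.equiv 𝕜 _ W f (btgt b)‖)) ^ 2 := by
      gcongr
    nlinarith [hc₀.le]
  calc ∑ b : Bond d Pd, c₀ * ‖WL2.equiv 𝕜 _ W (covDerivL2K 𝕜 c₀ c R f - covDerivL2K 𝕜 c₀ c R' f) b‖ ^ 2
      ≤ ∑ b : Bond d Pd, (‖c‖ * δR) ^ 2 * (c₀ * ‖WL2.equiv 𝕜 _ W f (btgt b)‖ ^ 2) := sum_le_sum fun b _ => hpt b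
    _ = (‖c‖ * δR) ^ 2 * (d * ∑ x : TSite d Pd, c₀ * ‖WL2.equiv 𝕜 _ W f x‖ ^ 2) := by
        rw [← mul_sum, sum_bond_btgt (fun x => c₀ * ‖WL2.equiv 𝕜 _ W f x‖ ^ 2)]
    _ = (‖c‖ * δR * Real.sqrt d) ^ 2 * ∑ x : TSite d Pd, c₀ * ‖WL2.equiv 𝕜 _ W f x‖ ^ 2 := by
        rw [mul_pow (‖c‖ * δR), Real.sq_sqrt (Nat.cast_nonneg d)]; ring

variable [FiniteDimensional 𝕜 W] {S S' : Bond d Pd → W →ₗ[𝕜] W}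

/-- **`D*` ((3.8)) BETWEEN TWO BACKGROUNDS BY ADJOINTNESS**: for `conj c = c` and mutually adjoint transporter data (`⟪R(b)v, u⟫ = ⟪v, S(b)u⟫`,
`⟪R′(b)v, u⟫ = ⟪v, S′(b)u⟫`) `D*_S − D*_{S′} = (D_R − D_{R′})†`, so `‖(D*_S − D*_{S′})A‖ ≤ ‖c‖·δR·√d·‖A‖`.
[cite: Balaban1985BackgroundPropagators, (3.8) p.392, (3.71) p.405] -/
theorem norm_covDivL2K_sub_le₂ (hc : conj c = c) (hδR : 0 ≤ δR) (hRR' : ∀ b w, ‖R b w - R' b w‖ ≤ δR * ‖w‖)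
    (hRS : ∀ (b : Bond d Pd) (v u : W), ⟪R b v, u⟫_𝕜 = ⟪v, S b u⟫_𝕜)
    (hRS' : ∀ (b : Bond d Pd) (v u : W), ⟪R' b v, u⟫_𝕜 = ⟪v, S' b u⟫_𝕜) (A : BondL2K 𝕜 d Pd c₀ W) :
    ‖covDivL2K 𝕜 c₀ c S A - covDivL2K 𝕜 c₀ c S' A‖ ≤ ‖c‖ * δR * Real.sqrt d * ‖A‖ := by
  rw [← adjoint_covDerivL2K c hc R S hRS, ← adjoint_covDerivL2K c hc R' S' hRS', ← LinearMap.sub_apply, ← map_sub]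
  exact norm_adjoint_apply_le _ (by positivity) (fun f => by rw [LinearMap.sub_apply]; exact norm_covDerivL2K_sub_le₂ c hδR hRR' f) A

/-- **THE REMAINDER OF THE COVARIANT LAPLACIAN `Δ^η_U = D*_U D_U` ((3.23)) ON THE GAUGE PARAMETERS BETWEEN TWO BACKGROUNDS**: with both data
`εR`-close to the identity and `δR`-close to each other, `‖(Δ_{R,S} − Δ_{R′,S′})λ‖ ≤ 4(1 + εR)·‖c‖²·d·δR·‖λ‖`
(`= D*_S(D_R − D_{R′}) + (D*_S − D*_{S′})D_{R′}`). [cite: Balaban1985BackgroundPropagators, (3.23) p.394, (3.71)–(3.73) p.405] -/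
theorem norm_covLaplaceSiteK_sub_le₂ (hc : conj c = c) (hεR : 0 ≤ εR) (hδR : 0 ≤ δR)
    (hR : ∀ b w, ‖R b w - w‖ ≤ εR * ‖w‖) (hR' : ∀ b w, ‖R' b w - w‖ ≤ εR * ‖w‖) (hRR' : ∀ b w, ‖R b w - R' b w‖ ≤ δR * ‖w‖)
    (hRS : ∀ (b : Bond d Pd) (v u : W), ⟪R b v, u⟫_𝕜 = ⟪v, S b u⟫_𝕜)
    (hRS' : ∀ (b : Bond d Pd) (v u : W), ⟪R' b v, u⟫_𝕜 = ⟪v, S' b u⟫_𝕜) (l : SiteL2K 𝕜 d Pd c₀ W) :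
    ‖covLaplaceSiteK c R S l - covLaplaceSiteK c R' S' l‖ ≤ 4 * (1 + εR) * ‖c‖ ^ 2 * d * δR * ‖l‖ := by
  have hsplit : covLaplaceSiteK c R S l - covLaplaceSiteK c R' S' l =
      covDivL2K 𝕜 c₀ c S (covDerivL2K 𝕜 c₀ c R l - covDerivL2K 𝕜 c₀ c R' l) +
        (covDivL2K 𝕜 c₀ c S (covDerivL2K 𝕜 c₀ c R' l) - covDivL2K 𝕜 c₀ c S' (covDerivL2K 𝕜 c₀ c R' l)) := by
    simp only [covLaplaceSiteK, LinearMap.comp_apply, map_sub]; abel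
  have h1 := norm_covDivL2K_le c hc hεR hR hRS (covDerivL2K 𝕜 c₀ c R l - covDerivL2K 𝕜 c₀ c R' l)
  have h2 := norm_covDerivL2K_sub_le₂ c hδR hRR' l
  have h3 := norm_covDivL2K_sub_le₂ c hc hδR hRR' hRS hRS' (covDerivL2K 𝕜 c₀ c R' l)
  have h4 := norm_covDerivL2K_le c hεR hR' l
  have hd : Real.sqrt d * Real.sqrt d = d := Real.mul_self_sqrt (Nat.cast_nonneg d)
  rw [hsplit]
  calc _ ≤ ‖covDivL2K 𝕜 c₀ c S (covDerivL2K 𝕜 c₀ c R l - covDerivL2K 𝕜 c₀ c R' l)‖ +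
        ‖covDivL2K 𝕜 c₀ c S (covDerivL2K 𝕜 c₀ c R' l) - covDivL2K 𝕜 c₀ c S' (covDerivL2K 𝕜 c₀ c R' l)‖ := norm_add_le _ _
    _ ≤ 2 * (1 + εR) * ‖c‖ * Real.sqrt d * (‖c‖ * δR * Real.sqrt d * ‖l‖) +
        ‖c‖ * δR * Real.sqrt d * (2 * (1 + εR) * ‖c‖ * Real.sqrt d * ‖l‖) :=
        add_le_add (h1.trans (mul_le_mul_of_nonneg_left h2 (by positivity))) (h3.trans (mul_le_mul_of_nonneg_left h4 (by positivity)))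
    _ = 4 * (1 + εR) * ‖c‖ ^ 2 * (Real.sqrt d * Real.sqrt d) * δR * ‖l‖ := by ring
    _ = 4 * (1 + εR) * ‖c‖ ^ 2 * d * δR * ‖l‖ := by rw [hd]

end Deriv

/-! ## §2 The curl `D` on bond functions ((3.4)) and the principal part `D*D` of (3.10) between two backgrounds -/

section Curl

variable {𝕜 : Type*} [RCLike 𝕜] {d : ℕ} {Pd : Fin d → ℕ} {W : Type*} [NormedAddCommGroup W] [InnerProductSpace 𝕜 W]
  {c₀ : ℝ} [Fact (0 < c₀)] (c : 𝕜)
  {R R' : Bond d Pd → W →ₗ[𝕜] W} {εR δR : ℝ}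

/-- pointwise: the curl difference at a plaquette between two transporter data carries a factor `R(b) − R′(b)` on the two transported edges
`e₀`, `e₃`. [folklore] [cite: Balaban1985BackgroundPropagators, (3.70) p.404] -/
theorem norm_covCurl_sub_apply_le₂ (hδR : 0 ≤ δR) (hRR' : ∀ b w, ‖R b w - R' b w‖ ≤ δR * ‖w‖)
    (A : Bond d Pd → W) (p : B9SectCLatticeCarrier.Plaq d Pd) :
    ‖B9Eq34CovCurlVector.covCurl c R A p - B9Eq34CovCurlVector.covCurl c R' A p‖ ≤ ‖c‖ * δR * ∑ k : Fin 4, ‖A (edgeBond p k)‖ := by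
  obtain ⟨x, q⟩ := p
  rw [covCurl_apply_coord, covCurl_apply_coord]
  have hsplit : c • (R (x, q.1.1) (A (shift q.1.1 x, q.1.2)) - A (x, q.1.2)) - c • (R (x, q.1.2) (A (shift q.1.2 x, q.1.1)) - A (x, q.1.1)) -
      (c • (R' (x, q.1.1) (A (shift q.1.1 x, q.1.2)) - A (x, q.1.2)) - c • (R' (x, q.1.2) (A (shift q.1.2 x, q.1.1)) - A (x, q.1.1))) =
      c • (R (x, q.1.1) (A (shift q.1.1 x, q.1.2)) - R' (x, q.1.1) (A (shift q.1.1 x, q.1.2))) -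
        c • (R (x, q.1.2) (A (shift q.1.2 x, q.1.1)) - R' (x, q.1.2) (A (shift q.1.2 x, q.1.1))) := by
    simp only [smul_sub]; abel
  rw [hsplit]
  have h0 := hRR' (x, q.1.2) (A (shift q.1.2 x, q.1.1))
  have h3 := hRR' (x, q.1.1) (A (shift q.1.1 x, q.1.2))
  have hsum : ∑ k : Fin 4, ‖A (edgeBond (x, q) k)‖ =
      ‖A (shift q.1.2 x, q.1.1)‖ + ‖A (x, q.1.2)‖ + ‖A (x, q.1.1)‖ + ‖A (shift q.1.1 x, q.1.2)‖ := by
    simp only [Fin.sum_univ_four, edgeBond, Matrix.cons_val_zero, Matrix.cons_val_one, Matrix.cons_val]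
  rw [hsum]
  calc ‖c • (R (x, q.1.1) (A (shift q.1.1 x, q.1.2)) - R' (x, q.1.1) (A (shift q.1.1 x, q.1.2))) -
        c • (R (x, q.1.2) (A (shift q.1.2 x, q.1.1)) - R' (x, q.1.2) (A (shift q.1.2 x, q.1.1)))‖
      ≤ ‖c • (R (x, q.1.1) (A (shift q.1.1 x, q.1.2)) - R' (x, q.1.1) (A (shift q.1.1 x, q.1.2)))‖ +
        ‖c • (R (x, q.1.2) (A (shift q.1.2 x, q.1.1)) - R' (x, q.1.2) (A (shift q.1.2 x, q.1.1)))‖ := norm_sub_le _ _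
    _ ≤ ‖c‖ * (δR * ‖A (shift q.1.1 x, q.1.2)‖) + ‖c‖ * (δR * ‖A (shift q.1.2 x, q.1.1)‖) := by
        rw [norm_smul, norm_smul]
        exact add_le_add (mul_le_mul_of_nonneg_left h3 (norm_nonneg _)) (mul_le_mul_of_nonneg_left h0 (norm_nonneg _))
    _ ≤ ‖c‖ * δR * (‖A (shift q.1.2 x, q.1.1)‖ + ‖A (x, q.1.2)‖ + ‖A (x, q.1.1)‖ + ‖A (shift q.1.1 x, q.1.2)‖) := by
        have := mul_nonneg (norm_nonneg c) hδR
        nlinarith [norm_nonneg (A (x, q.1.2)), norm_nonneg (A (x, q.1.1))]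

/-- **THE REMAINDER OF THE CURL `D_U` ((3.4)) AGAINST `D_{U′}` ON `L²`**: `‖(D_R − D_{R′})A‖ ≤ 4√d·‖c‖·δR·‖A‖`.
[cite: Balaban1985BackgroundPropagators, (3.4) p.391, (3.70)–(3.73) pp.404–405] -/
theorem norm_covCurlL2K_sub_le₂ (hδR : 0 ≤ δR) (hRR' : ∀ b w, ‖R b w - R' b w‖ ≤ δR * ‖w‖) (A : BondL2K 𝕜 d Pd c₀ W) :
    ‖covCurlL2K 𝕜 c₀ c R A - covCurlL2K 𝕜 c₀ c R' A‖ ≤ 4 * Real.sqrt d * (‖c‖ * δR) * ‖A‖ :=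
  norm_plaq_le_of_edge_bound A _ (by positivity) fun p => by
    rw [WL2.equiv_sub, Pi.sub_apply, equiv_covCurlL2K, equiv_covCurlL2K]
    exact norm_covCurl_sub_apply_le₂ c hδR hRR' _ p

variable [FiniteDimensional 𝕜 W] {S S' : Bond d Pd → W →ₗ[𝕜] W}

/-- **THE REMAINDER OF THE PRINCIPAL PART `D*_U D_U` OF (3.10) BETWEEN TWO BACKGROUNDS ON `L²`** — print's `V₁(A)` of (3.71) ∕ the `D*D`-part of
`V₃(A)` of (3.82) AT A GENERAL `U`, as a crude operator bound: with `D* = D†` (mutually adjoint transporters, `conj c = c`), both data `εR`-close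
to the identity and `δR`-close to each other, `‖(D*_S D_R − D*_{S′} D_{R′})A‖ ≤ 32d·(1 + εR)·‖c‖²·δR·‖A‖`.
[cite: Balaban1985BackgroundPropagators, (3.10) p.392, (3.70)–(3.73) pp.404–405, (3.82) p.407] -/
theorem norm_principal_sub_le₂ (hc : conj c = c) (hεR : 0 ≤ εR) (hδR : 0 ≤ δR)
    (hR : ∀ b w, ‖R b w - w‖ ≤ εR * ‖w‖) (hR' : ∀ b w, ‖R' b w - w‖ ≤ εR * ‖w‖) (hRR' : ∀ b w, ‖R b w - R' b w‖ ≤ δR * ‖w‖)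
    (hRS : ∀ (b : Bond d Pd) (v u : W), ⟪R b v, u⟫_𝕜 = ⟪v, S b u⟫_𝕜)
    (hRS' : ∀ (b : Bond d Pd) (v u : W), ⟪R' b v, u⟫_𝕜 = ⟪v, S' b u⟫_𝕜) (A : BondL2K 𝕜 d Pd c₀ W) :
    ‖covCoCurlL2K 𝕜 c₀ c S (covCurlL2K 𝕜 c₀ c R A) - covCoCurlL2K 𝕜 c₀ c S' (covCurlL2K 𝕜 c₀ c R' A)‖ ≤
      32 * d * (1 + εR) * ‖c‖ ^ 2 * δR * ‖A‖ := by
  -- `D*_S = (D_R)†`, `D*_{S′} = (D_{R′})†`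
  rw [← adjoint_covCurlL2K c hc R S hRS, ← adjoint_covCurlL2K c hc R' S' hRS']
  have hsplit : LinearMap.adjoint (covCurlL2K 𝕜 c₀ c R) (covCurlL2K 𝕜 c₀ c R A) - LinearMap.adjoint (covCurlL2K 𝕜 c₀ c R') (covCurlL2K 𝕜 c₀ c R' A) =
      LinearMap.adjoint (covCurlL2K 𝕜 c₀ c R) (covCurlL2K 𝕜 c₀ c R A - covCurlL2K 𝕜 c₀ c R' A) +
        LinearMap.adjoint (covCurlL2K 𝕜 c₀ c R - covCurlL2K 𝕜 c₀ c R') (covCurlL2K 𝕜 c₀ c R' A) := by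
    rw [map_sub, map_sub, LinearMap.sub_apply]; abel
  have h1 : ∀ y, ‖LinearMap.adjoint (covCurlL2K 𝕜 c₀ c R) y‖ ≤ 4 * Real.sqrt d * ((1 + εR) * ‖c‖) * ‖y‖ :=
    norm_adjoint_apply_le _ (by positivity) (norm_covCurlL2K_le c hεR hR)
  have h2 : ∀ y, ‖LinearMap.adjoint (covCurlL2K 𝕜 c₀ c R - covCurlL2K 𝕜 c₀ c R') y‖ ≤ 4 * Real.sqrt d * (‖c‖ * δR) * ‖y‖ :=
    norm_adjoint_apply_le _ (by positivity) fun B => by rw [LinearMap.sub_apply]; exact norm_covCurlL2K_sub_le₂ c hδR hRR' B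
  have h3 := norm_covCurlL2K_sub_le₂ c hδR hRR' A
  have h4 := norm_covCurlL2K_le c hεR hR' A
  have hd : Real.sqrt d * Real.sqrt d = d := Real.mul_self_sqrt (Nat.cast_nonneg d)
  rw [hsplit]
  calc _ ≤ ‖LinearMap.adjoint (covCurlL2K 𝕜 c₀ c R) (covCurlL2K 𝕜 c₀ c R A - covCurlL2K 𝕜 c₀ c R' A)‖ +
        ‖LinearMap.adjoint (covCurlL2K 𝕜 c₀ c R - covCurlL2K 𝕜 c₀ c R') (covCurlL2K 𝕜 c₀ c R' A)‖ := norm_add_le _ _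
    _ ≤ 4 * Real.sqrt d * ((1 + εR) * ‖c‖) * (4 * Real.sqrt d * (‖c‖ * δR) * ‖A‖) +
        4 * Real.sqrt d * (‖c‖ * δR) * (4 * Real.sqrt d * ((1 + εR) * ‖c‖) * ‖A‖) :=
        add_le_add ((h1 _).trans (mul_le_mul_of_nonneg_left h3 (by positivity))) ((h2 _).trans (mul_le_mul_of_nonneg_left h4 (by positivity)))
    _ = 32 * (Real.sqrt d * Real.sqrt d) * (1 + εR) * ‖c‖ ^ 2 * δR * ‖A‖ := by ring
    _ = 32 * d * (1 + εR) * ‖c‖ ^ 2 * δR * ‖A‖ := by rw [hd]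

end Curl

end Literature.MathematicalPhysics.QuantumFieldTheory.Balaban1983to89.B9Eq373DerivativeRemainderTwoBackgrounds

end
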